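import Summits.HodgeConjecture.HodgeConjecture.Theorems.Q8SymplecticPowersRegularOfOneFibre
import HarnessLib

/-!
# Route `Q8SymplecticPowers`, crux K1Q (stmt-HodgeConjecture-24190), line `mechanism-v2`: stub S1 `stub_regularVeryGeneralQ`
# REDUCED, KOLLÁR-FREE AND DECK-FREE, TO ONE REGULAR FIBRE OF ANY SMOOTH PROJECTIVE FAMILY OF QUARTIC MODELS

Helper file (`--supports stmt-HodgeConjecture-24190`; nothing here closes an item). Sorry-free; axioms standard; no definition;
no named fact.

The tree's reduction `Q8SymplecticPowersRegularOfOneFibre.stub_regularVeryGeneralQ_of_oneFibre hK HQ` (prover-Bx g20) of the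
registered stub S1 «very generally every smooth projective `X ~bir V_(c,ψ)` has `b₁(X) = 0`» takes Kollár's lifting fact `hK` (to
produce the line's deck family S6) and a `∀`-MODEL hypothesis `HQ` (EVERY deck-family package has a fibre with `b₁ = 0`). Neither is
needed: the proof only uses that SOME smooth projective family over a non-empty open `W` of the parameter space
`Spec ℂ[a_i | i ∈ CIdx e]`, with smooth quasi-projective base, has fibres birational to `V_(c(t),ψ(t))` off the zero set of one
non-zero coefficient polynomial `g₀` and ONE fibre with `b₁ = 0` — no deck pair `τ, j`, no equivariance, no print input. This file
records S1 in that ∃-PACKAGED, deck-free currency (the typing lesson T8 of the line card: per-family ∃-packages, not ∀-model clauses):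

* `stub_regularVeryGeneralQ_of_exists_regularFibre` — S1 VERBATIM from `RegularFibreFamilyQ`-shaped data written out inline:
  `∀ even e ≥ 4, ∃ (W, 𝒳, π, g₀)`, `g₀ ≠ 0`, `W(ℂ) ≠ ∅`, `π` smooth projective of relative dimension `2`, `base W` quasi-projective and
  smooth of relative dimension `#CIdx e`, every fibre `X_t` with `g₀(a(t)) ≠ 0` birational over `ℂ` to every hypersurface cut out by
  the quartic form of `a(t)`, and SOME fibre `X_{a₀}` with `finrank_ℚ H¹(X_{a₀}(ℂ); ℚ) = 0`.
  PROOF (= Bx's, minus S6): `W(ℂ)` is path connected (`Q8SymplecticPowersRegularOfOneFibre.pathConnectedSpace_complexPoints_base`), so `b₁` is constant on fibres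
  (Ehresmann, `finrank_bettiCohomology_fiberOver_eq_of_joined`); the genericity polynomials (G7 `exists_genericityPolynomials`, no bad
  set, `g₀`) put over every admissible `(c, ψ)` off their zero sets a point `t ∈ W(ℂ)` with `a(t) ↦ (c, ψ)` and `g₀(a(t)) ≠ 0`; `b₁` is
  a birational invariant of smooth projective surfaces (`finrank_bettiCohomology_one_eq_of_birationalOver`).
* `stub_regularVeryGeneralQ_of_exists_chartFamily_regularFibre` — the same from the CHART currency of the line (an open immersion
  `ι` of the deck chart `deckChart ⊗ W` into `𝒳` over `W`, surjective onto `W`; fibrewise birationality is then G8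
  `birationalOver_fiberOver_of_deckClauses` with `g₀ := genericityElem e`), still with no deck pair and no Kollár binder.

So the residue of S1 is: ONE chart-compatible (or fibrewise-birational) smooth projective family of quartic models per even `e ≥ 4`
— constructible from the tree's PROVED projective Hironaka (`Resolution.exists_isResolution_isProjectiveOver_of_isProjectiveOver`)
plus spreading out, no automorphism lifting required — together with ONE fibre of irregularity `0` (in print: the irregularity of
the cyclic quartic plane `w⁴ = c·(σc)³·(x₀−x₁)²·ψ²`, Naie 2007 Thm. 1.1 ∕ Esnault–Viehweg 1982).

Honest scope: a reduction; S1, K1Q, HC are NOT proved here.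

References: R. Hartshorne, *Algebraic Geometry*, II Ex. 8.8, V Rem. 5.6.1; C. Voisin, *Hodge Theory I*, §9.1.1 Thm. 9.3; D. Naie,
*The irregularity of cyclic multiple planes after Zariski*, Enseign. Math. 53 (2007), Thm. 1.1.
-/

set_option linter.dupNamespace false

noncomputable section

open CategoryTheory AlgebraicGeometry MonoidalCategory CartesianMonoidalCategory
open Literature.AlgebraicGeometry Literature.AlgebraicGeometry.Motives Literature.AlgebraicGeometry.HodgeTheory
open Literature.AlgebraicGeometry.HodgeTheory.BettiUniverse Literature.AlgebraicGeometry.HodgeTheory.Q8Family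
open Literature.AlgebraicGeometry.RelativeSpec Literature.AlgebraicGeometry.RelativeSpec.ActionOver

namespace Summit.HodgeConjecture.HodgeConjecture.Theorems.Q8SymplecticPowersRegularOfFamilyOneFibre

/-- **S1 from ONE regular fibre of ANY smooth projective family of quartic models (∃-package, Kollár-free, deck-free).**
If for every even `e ≥ 4` there are a non-empty open `W ⊆ Spec ℂ[a]`, a smooth projective family `π : 𝒳 ⟶ base W` of surfaces over
the smooth quasi-projective `base W`, and `0 ≠ g₀ ∈ ℂ[a]` such that every fibre `X_t` with `g₀(a(t)) ≠ 0` is birational over `ℂ`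
to every hypersurface of `ℙ³` cut out by the quartic form of `a(t)`, and SOME fibre has `b₁ = 0`, then the registered statement of
S1 holds: very generally every smooth projective `X` birational over `ℂ` to `V_(c,ψ)` has `b₁(X) = 0` (module docstring).
[cite: Hartshorne1977, II Ex. 8.8 and V Remark 5.6.1] [cite: VoisinHodgeI2002, §9.1.1 Thm. 9.3] -/
theorem stub_regularVeryGeneralQ_of_exists_regularFibre
    (H : ∀ ⦃e : ℕ⦄, Even e → 4 ≤ e → ∃ (W : (Spec (.of (ParamRing e))).Opens) (𝒳 : SchemeOver ℂ) (π : 𝒳 ⟶ base W)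
      (g₀ : ParamRing e), g₀ ≠ 0 ∧ Nonempty (ComplexPoints (base W)) ∧ ∃ (_ : IsSmoothProjectiveFamily π 2)
      (_ : IsQuasiProjectiveOver (base W)) (_ : AlgebraicGeometry.SmoothOfRelativeDimension (Fintype.card (CIdx e)) (base W).hom),
      (∀ t : ComplexPoints (base W), MvPolynomial.eval (coeffs W t) g₀ ≠ 0 → ∀ ⦃V : SchemeOver ℂ⦄,
        IsHypersurfaceCutOutBy 3 (quarticForm e (cOf (coeffs W t)) (ψOf (coeffs W t))) V →
          AlgebraicGeometry.Scheme.BirationalOver (fiberOver π t).hom V.hom) ∧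
      ∃ a₀ : ComplexPoints (base W), Module.finrank ℚ (bettiCohomology (fiberOver π a₀) 1) = 0) :
open Literature.AlgebraicGeometry.Motives Literature.AlgebraicGeometry.HodgeTheory Literature.AlgebraicGeometry.HodgeTheory.BettiUniverse CategoryTheory.Limits in ∀ ⦃e : ℕ⦄, Even e → 4 ≤ e → ∃ G : ℕ → MvPolynomial ({d : Fin 3 →₀ ℕ // d.degree = 1} ⊕ {d : Fin 3 →₀ ℕ // d.degree = e - 1}) ℂ, (∀ i, ∃ c ψ : MvPolynomial (Fin 3) ℂ, c.IsHomogeneous 1 ∧ ψ.IsHomogeneous (e - 1) ∧ MvPolynomial.rename (Equiv.swap (0 : Fin 3) 1) ψ = ψ ∧ MvPolynomial.eval (Sum.elim (fun d => c.coeff d.1) (fun d => ψ.coeff d.1)) (G i) ≠ 0) ∧ ∀ c ψ : MvPolynomial (Fin 3) ℂ, c.IsHomogeneous 1 → ψ.IsHomogeneous (e - 1) → MvPolynomial.rename (Equiv.swap (0 : Fin 3) 1) ψ = ψ → (∀ i, MvPolynomial.eval (Sum.elim (fun d => c.coeff d.1) (fun d => ψ.coeff d.1)) (G i) ≠ 0)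 → ∀ ⦃V X : SchemeOver ℂ⦄ (hX : IsSmoothProjective 2 X), IsHypersurfaceCutOutBy 3 (MvPolynomial.X (Fin.last 3) ^ 4 * MvPolynomial.X (Fin.castSucc 2) ^ (2 * e) - MvPolynomial.rename Fin.castSucc (c * MvPolynomial.rename (Equiv.swap (0 : Fin 3) 1) c ^ 3 * ((MvPolynomial.X 0 - MvPolynomial.X 1) * ψ) ^ 2)) V → AlgebraicGeometry.Scheme.BirationalOver X.hom V.hom → Module.finrank ℚ (bettiCohomology X 1) = 0 := by
  intro e he h4
  obtain ⟨W, 𝒳, π, g₀, hg₀, hne, hπ, hqpW, hsm, hbir, a₀, ha₀⟩ := H he h4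
  haveI := hsm
  haveI : PathConnectedSpace (ComplexPoints (base W)) :=
    Q8SymplecticPowersRegularOfOneFibre.pathConnectedSpace_complexPoints_base (m := Fintype.card (CIdx e)) W hne
  -- the genericity polynomials, with no bad set
  have hBad : ∀ j : ℕ, IsZariskiClosedOnPoints (base W) ((fun _ : ℕ => (∅ : Set (ComplexPoints (base W)))) j) ∧
      (fun _ : ℕ => (∅ : Set (ComplexPoints (base W)))) j ≠ Set.univ := by
    intro j'
    refine ⟨⟨∅, isClosed_empty, by ext P; simp⟩, ?_⟩
    obtain ⟨t₀⟩ := hne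
    intro h
    have ht₀ : t₀ ∈ (Set.univ : Set (ComplexPoints (base W))) := Set.mem_univ _
    rw [← h] at ht₀
    exact ht₀
  obtain ⟨G, hGne, hGpt⟩ := Q8SymplecticPowersGenericityPolynomials.exists_genericityPolynomials W hne (fun _ => ∅) hBad g₀ hg₀
  refine ⟨G, hGne, ?_⟩
  intro c ψ hc hψ hψσ hGi V X hX hV hbirX
  obtain ⟨t, htc, htψ, -, hGe⟩ := hGpt c ψ hc hψ hψσ hGi
  -- the fibre over `t` is birational to `V_(c,ψ)`, hence to `X`
  have hbV := hbir t hGe (V := V) (by rw [htc, htψ]; exact hV)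
  rw [finrank_bettiCohomology_one_eq_of_birationalOver hX (hπ.isSmoothProjective t) (hbirX.trans hbV.symm),
    finrank_bettiCohomology_fiberOver_eq_of_joined π hπ hqpW (d := Fintype.card (CIdx e)) (PathConnectedSpace.joined t a₀) 1]
  exact ha₀

/-- **S1 from ONE regular fibre of a chart-compatible smooth projective family (deck-free, Kollár-free).** The same with the
fibrewise birationality supplied by the line's CHART clauses (an open immersion `ι` of the deck chart `deckChart ⊗ W` into `𝒳` over
`W`, surjective onto `W`) through G8 `birationalOver_fiberOver_of_deckClauses` at `g₀ := genericityElem e`; no deck pair `τ, j`, no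
equivariance clause and no print input is consumed. [cite: Hartshorne1977, II Ex. 8.8 and V Remark 5.6.1]
[cite: VoisinHodgeI2002, §9.1.1 Thm. 9.3] -/
theorem stub_regularVeryGeneralQ_of_exists_chartFamily_regularFibre
    (H : ∀ ⦃e : ℕ⦄, Even e → 4 ≤ e → ∃ (W : (Spec (.of (ParamRing e))).Opens) (𝒳 : SchemeOver ℂ) (π : 𝒳 ⟶ base W)
      (ι : (deckChart (fun i => (MvPolynomial.X i : ParamRing e)) ⊗ Over.mk W.ι).left ⟶ 𝒳.left),
      Nonempty (ComplexPoints (base W)) ∧ ∃ (_ : IsSmoothProjectiveFamily π 2) (_ : IsQuasiProjectiveOver (base W))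
      (_ : AlgebraicGeometry.SmoothOfRelativeDimension (Fintype.card (CIdx e)) (base W).hom) (_ : IsOpenImmersion ι),
      ι ≫ π.left = (snd (deckChart (fun i => (MvPolynomial.X i : ParamRing e))) (Over.mk W.ι)).left ∧
      Function.Surjective (snd (deckChart (fun i => (MvPolynomial.X i : ParamRing e))) (Over.mk W.ι)).left ∧
      ∃ a₀ : ComplexPoints (base W), Module.finrank ℚ (bettiCohomology (fiberOver π a₀) 1) = 0) :
open Literature.AlgebraicGeometry.Motives Literature.AlgebraicGeometry.HodgeTheory Literature.AlgebraicGeometry.HodgeTheory.BettiUniverse CategoryTheory.Limits in ∀ ⦃e : ℕ⦄, Even e → 4 ≤ e → ∃ G : ℕ → MvPolynomial ({d : Fin 3 →₀ ℕ // d.degree = 1} ⊕ {d : Fin 3 →₀ ℕ // d.degree = e - 1}) ℂ, (∀ i, ∃ c ψ : MvPolynomial (Fin 3) ℂ, c.IsHomogeneous 1 ∧ ψ.IsHomogeneous (e - 1) ∧ MvPolynomial.rename (Equiv.swap (0 : Fin 3) 1) ψ = ψ ∧ MvPolynomial.eval (Sum.elim (fun d => c.coeff d.1) (fun d => ψ.coeff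 d.1)) (G i) ≠ 0) ∧ ∀ c ψ : MvPolynomial (Fin 3) ℂ, c.IsHomogeneous 1 → ψ.IsHomogeneous (e - 1) → MvPolynomial.rename (Equiv.swap (0 : Fin 3) 1) ψ = ψ → (∀ i, MvPolynomial.eval (Sum.elim (fun d => c.coeff d.1) (fun d => ψ.coeff d.1)) (G i) ≠ 0) → ∀ ⦃V X : SchemeOver ℂ⦄ (hX : IsSmoothProjective 2 X), IsHypersurfaceCutOutBy 3 (MvPolynomial.X (Fin.last 3) ^ 4 * MvPolynomial.X (Fin.castSucc 2) ^ (2 * e) - MvPolynomial.rename Fin.castSucc (c * MvPolynomial.rename (Equiv.swap (0 : Fin 3) 1) c ^ 3 * ((MvPolynomial.X 0 - MvPolynomial.X 1) * ψ) ^ 2)) V → AlgebraicGeometry.Scheme.BirationalOver X.hom V.hom → Module.finrank ℚ (bettiCohomology X 1) = 0 := by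
  refine stub_regularVeryGeneralQ_of_exists_regularFibre fun e he h4 => ?_
  obtain ⟨W, 𝒳, π, ι, hne, hπ, hqpW, hsm, hιo, hιπ, hsurj, a₀, ha₀⟩ := H he h4
  refine ⟨W, 𝒳, π, genericityElem e, genericityElem_ne_zero e (by omega), hne, hπ, hqpW, hsm, ?_, a₀, ha₀⟩
  intro t hGe V hV
  exact Q8SymplecticPowersFibreBirational.birationalOver_fiberOver_of_deckClauses (by omega) W 𝒳 π ι hπ hιo hιπ hsurj t hGe hV

end Summit.HodgeConjecture.HodgeConjecture.Theorems.Q8SymplecticPowersRegularOfFamilyOneFibre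

end
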